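import Mathlib
import HarnessLib
import Summits.Ventures.LatticeQCDFlow.Exactness.RadialPolar
import Summits.Ventures.LatticeQCDFlow.Exactness.SphereGeodesicKick

/-!
# Axis coordinates on `ℝ^{n+2}`: the polar axis, the equatorial embedding `ℝ^{n+1} ↪ ℝ^{n+2}`, and the latitude map `(θ, w) ↦ cos θ · e₀ + sin θ · (0, w)` onto the sphere `S^{n+1}`

HONEST FRAMING: exact (Metropolis-corrected) sampling algorithms for lattice gauge theory;
figures of merit are autocorrelation/cost numbers at stated couplings and volumes; no
continuum-physics claim.

Venture `LatticeQCDFlow` (cell pub-lqcd), topic `Exactness`; FANOUT row 7 (`s0-cpn-null`: the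
S0-D1 rung — 2D CP⁹, Lüscher's LO trivializing map inside HMC, Engel–Schaefer 2011).  NEW WORK of
the cell over Mathlib (`EuclideanSpace`, `MeasurableEquiv.piFinSuccAbove`,
`PiLp.volume_preserving_ofLp/toLp`, `InnerProductGeometry.angle`) and the tree's
`Exactness/RadialPolar.lean` (`dirSphere`) and `Exactness/SphereGeodesicKick.lean` (`geodesicKick`,
`norm_meridian`, `geodesicKick_meridian`); nothing is cited as a fact.  Printed counterpart, NAMED
ONLY: Engel–Schaefer, Comput. Phys. Commun. 182 (2011) 2107, §3 eqs. (17)–(18) (the single-site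
update written in the polar angle from the local-field axis).

This file is the coordinate bookkeeping for the AXIS (LATITUDE) DISINTEGRATION of the sphere
measure (`Exactness/SphereAxisDisintegration.lean`): the one identification that
`KickAngleJacobian.lean` / `SphereGeodesicKick.lean` name as NOT CLAIMED.  Indexing: the ambient
space is `ℝ^{n+2}` (site sphere `S^{n+1}`, equator `S^n ⊂ ℝ^{n+1}`, polar-law exponent `n`); for
the CP(N−1) site sphere `S^{2N−1}` this is `n = 2N − 2` (no natural-number subtraction anywhere).

## Content

* `polarAxis n = e₀ = (1, 0, …, 0) ∈ ℝ^{n+2}`; `equatorEmbed n : ℝ^{n+1} →ₗᵢ ℝ^{n+2}`, `y ↦ (0, y)`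
  (a linear isometry with `⟪e₀, (0, y)⟫ = 0`).
* `axisCoords n : ℝ^{n+2} ≃ᵐ ℝ × ℝ^{n+1}`, `x ↦ (x₀, (x₁, …))`, **volume preserving**
  (`measurePreserving_axisCoords`), with inverse `(t, y) ↦ t • e₀ + (0, y)`
  (`axisCoords_symm_apply_eq`) of squared norm `t² + ‖y‖²` (`norm_sq_axisCoords_symm`).
* `latitudePt n θ w ∈ S^{n+1}` — the point at polar angle `θ` above the equatorial point
  `w ∈ S^n`: `cos θ • e₀ + sin θ • (0, w)`; jointly continuous (`continuous_latitudePt`);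
  `⟪e₀, latitudePt θ w⟫ = cos θ`, **`angle_polarAxis_latitudePt`** (`= θ` on `[0, π]`);
  `axisCoords_symm_polar`: `(r cos θ, (r sin θ) • w) ↦ r • latitudePt θ w` — the line along which
  the two-dimensional polar coordinates enter the disintegration.
* `dirSphere_smul_coe` (`dirSphere (r • u) = u` for `r > 0`, `u` on the sphere).
* **`geodesicKick_latitudePt`** — the Engel–Schaefer LO site update with local field `r • e₀`
  maps `latitudePt θ w ↦ latitudePt (kickAngle (c r) θ) w` for `θ ∈ (0, π)`: in latitude
  coordinates the kick is `kickAngle (c r) × id` (`SphereGeodesicKick.geodesicKick_meridian`).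

NOT CLAIMED here: anything about measures on the sphere (next file); general axes (obtained there
by a linear isometry).
-/

noncomputable section

namespace Summit.Ventures.LatticeQCDFlow.Exactness

open Real Set MeasureTheory InnerProductGeometry WithLp Metric
open scoped InnerProductSpace ENNReal

variable (n : ℕ)

/-! ## The axis and the equator -/

/-- The polar axis `e₀ = (1, 0, …, 0)` of `ℝ^{n+2}`. -/
def polarAxis : EuclideanSpace ℝ (Fin (n + 2)) := EuclideanSpace.single 0 1

/-- `e₀` has first coordinate `1` … -/
@[simp] theorem polarAxis_apply_zero : polarAxis n 0 = 1 := by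
  simp [polarAxis]

/-- … and all other coordinates `0`. -/
@[simp] theorem polarAxis_apply_succ (j : Fin (n + 1)) : polarAxis n j.succ = 0 := by
  simp [polarAxis, Fin.succ_ne_zero]

/-- `‖e₀‖ = 1`. -/
@[simp] theorem norm_polarAxis : ‖polarAxis n‖ = 1 := by
  simp [polarAxis]

/-- `e₀ ≠ 0`. -/
theorem polarAxis_ne_zero : polarAxis n ≠ 0 := by
  rw [← norm_ne_zero_iff, norm_polarAxis]; exact one_ne_zero

/-- `⟪e₀, x⟫ = x₀`. -/
theorem inner_polarAxis (x : EuclideanSpace ℝ (Fin (n + 2))) : ⟪polarAxis n, x⟫_ℝ = x 0 := by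
  rw [polarAxis, EuclideanSpace.inner_single_left]; simp

/-- The equatorial embedding `ℝ^{n+1} → ℝ^{n+2}`, `y ↦ (0, y₀, …, y_n)`: a linear isometry onto the
hyperplane orthogonal to the axis. -/
def equatorEmbed : EuclideanSpace ℝ (Fin (n + 1)) →ₗᵢ[ℝ] EuclideanSpace ℝ (Fin (n + 2)) where
  toFun y := toLp 2 (Fin.cons 0 (ofLp y))
  map_add' x y := by
    ext j
    refine Fin.cases ?_ (fun k => ?_) j <;> simp
  map_smul' c x := by
    ext j
    refine Fin.cases ?_ (fun k => ?_) j <;> simp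
  norm_map' y := by
    rw [EuclideanSpace.norm_eq, EuclideanSpace.norm_eq, Fin.sum_univ_succ]
    simp

/-- `(0, y)` has first coordinate `0` … -/
@[simp] theorem equatorEmbed_apply_zero (y : EuclideanSpace ℝ (Fin (n + 1))) :
    equatorEmbed n y 0 = 0 := rfl

/-- … and the remaining coordinates are those of `y`. -/
@[simp] theorem equatorEmbed_apply_succ (y : EuclideanSpace ℝ (Fin (n + 1))) (k : Fin (n + 1)) :
    equatorEmbed n y k.succ = y k := rfl

/-- The equator is orthogonal to the axis: `⟪e₀, (0, y)⟫ = 0`. -/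
theorem inner_polarAxis_equatorEmbed (y : EuclideanSpace ℝ (Fin (n + 1))) :
    ⟪polarAxis n, equatorEmbed n y⟫_ℝ = 0 := by
  rw [inner_polarAxis, equatorEmbed_apply_zero]

/-- `‖(0, y)‖ = ‖y‖`. -/
theorem norm_equatorEmbed (y : EuclideanSpace ℝ (Fin (n + 1))) : ‖equatorEmbed n y‖ = ‖y‖ :=
  (equatorEmbed n).norm_map y

/-! ## Axis coordinates `ℝ^{n+2} ≃ ℝ × ℝ^{n+1}` and the volume -/

/-- Axis coordinates `x ↦ (x₀, (x₁, …, x_{n+1}))`: a measurable equivalence `ℝ^{n+2} ≃ᵐ ℝ × ℝ^{n+1}`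
(Mathlib's `piFinSuccAbove` at the index `0`, conjugated by the `WithLp` identifications). -/
def axisCoords : EuclideanSpace ℝ (Fin (n + 2)) ≃ᵐ ℝ × EuclideanSpace ℝ (Fin (n + 1)) :=
  ((MeasurableEquiv.toLp 2 (Fin (n + 2) → ℝ)).symm.trans
    (MeasurableEquiv.piFinSuccAbove (fun _ => ℝ) 0)).trans
    (MeasurableEquiv.prodCongr (MeasurableEquiv.refl ℝ) (MeasurableEquiv.toLp 2 (Fin (n + 1) → ℝ)))

/-- **Axis coordinates are volume preserving**: Lebesgue measure on `ℝ^{n+2}` is the product of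
Lebesgue measure on the axis and on the equatorial hyperplane. -/
theorem measurePreserving_axisCoords :
    MeasurePreserving (axisCoords n) (volume : Measure (EuclideanSpace ℝ (Fin (n + 2))))
      ((volume : Measure ℝ).prod (volume : Measure (EuclideanSpace ℝ (Fin (n + 1))))) :=
  ((PiLp.volume_preserving_ofLp (Fin (n + 2))).trans
    (volume_preserving_piFinSuccAbove (fun _ => ℝ) 0)).trans
    ((MeasurePreserving.id (volume : Measure ℝ)).prod (PiLp.volume_preserving_toLp (Fin (n + 1))))

/-- The inverse of the axis coordinates inserts the first coordinate: `(t, y) ↦ (t, y₀, …, y_n)`. -/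
theorem axisCoords_symm_apply (t : ℝ) (y : EuclideanSpace ℝ (Fin (n + 1))) :
    (axisCoords n).symm (t, y) = toLp 2 (Fin.cons t (ofLp y)) := by
  show toLp 2 (Fin.insertNth (α := fun _ : Fin (n + 2) => ℝ) 0 t (ofLp y)) = _
  rw [Fin.insertNth_zero']

/-- The inverse of the axis coordinates in vector form: `(t, y) ↦ t • e₀ + (0, y)`. -/
theorem axisCoords_symm_apply_eq (t : ℝ) (y : EuclideanSpace ℝ (Fin (n + 1))) :
    (axisCoords n).symm (t, y) = t • polarAxis n + equatorEmbed n y := by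
  rw [axisCoords_symm_apply]
  ext j
  refine Fin.cases ?_ (fun k => ?_) j <;> simp

/-- `‖t • e₀ + (0, y)‖² = t² + ‖y‖²` (Pythagoras along the axis). -/
theorem norm_sq_axisCoords_symm (t : ℝ) (y : EuclideanSpace ℝ (Fin (n + 1))) :
    ‖(axisCoords n).symm (t, y)‖ ^ 2 = t ^ 2 + ‖y‖ ^ 2 := by
  rw [axisCoords_symm_apply_eq, norm_add_sq_real, norm_smul, norm_polarAxis, mul_one,
    real_inner_smul_left, inner_polarAxis_equatorEmbed, mul_zero, mul_zero, add_zero,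
    norm_equatorEmbed, Real.norm_eq_abs, sq_abs]

/-! ## The latitude map onto the sphere -/

/-- **The latitude map.**  The point of `S^{n+1} ⊂ ℝ^{n+2}` at polar angle `θ` from the axis `e₀`
above the equatorial point `w ∈ S^n ⊂ ℝ^{n+1}`: `cos θ • e₀ + sin θ • (0, w)` (a unit vector by
`SphereGeodesicKick.norm_meridian`).  For `θ ∈ (0, π)` this is a bijection onto the sphere minus
the two poles; `θ` outside `[0, π]` is never used (the polar law lives on `[0, π]`). -/
def latitudePt (θ : ℝ) (w : sphere (0 : EuclideanSpace ℝ (Fin (n + 1))) 1) :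
    sphere (0 : EuclideanSpace ℝ (Fin (n + 2))) 1 :=
  ⟨cos θ • polarAxis n + sin θ • equatorEmbed n w,
    mem_sphere_zero_iff_norm.2
      (norm_meridian (norm_polarAxis n) (by rw [norm_equatorEmbed]; exact norm_eq_of_mem_sphere w)
        (inner_polarAxis_equatorEmbed n w) θ)⟩

/-- The latitude map in vector form. -/
@[simp] theorem coe_latitudePt (θ : ℝ) (w : sphere (0 : EuclideanSpace ℝ (Fin (n + 1))) 1) :
    (latitudePt n θ w : EuclideanSpace ℝ (Fin (n + 2))) =
      cos θ • polarAxis n + sin θ • equatorEmbed n w := rfl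

/-- The latitude map is jointly continuous in `(θ, w)`. -/
theorem continuous_latitudePt :
    Continuous fun p : ℝ × sphere (0 : EuclideanSpace ℝ (Fin (n + 1))) 1 => latitudePt n p.1 p.2 := by
  refine Continuous.subtype_mk ?_ _
  exact ((continuous_cos.comp continuous_fst).smul continuous_const).add
    ((continuous_sin.comp continuous_fst).smul
      ((equatorEmbed n).continuous.comp (continuous_subtype_val.comp continuous_snd)))

/-- The latitude map is jointly measurable in `(θ, w)`. -/
theorem measurable_latitudePt :
    Measurable fun p : ℝ × sphere (0 : EuclideanSpace ℝ (Fin (n + 1))) 1 => latitudePt n p.1 p.2 :=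
  (continuous_latitudePt n).measurable

/-- For a fixed angle the latitude map is continuous in the equatorial point. -/
theorem continuous_latitudePt_right (θ : ℝ) : Continuous (latitudePt n θ) := by
  refine Continuous.subtype_mk ?_ _
  have h : Continuous fun w : sphere (0 : EuclideanSpace ℝ (Fin (n + 1))) 1 =>
      equatorEmbed n (w : EuclideanSpace ℝ (Fin (n + 1))) :=
    (equatorEmbed n).continuous.comp continuous_subtype_val
  fun_prop

/-- For a fixed angle the latitude map is measurable in the equatorial point. -/
theorem measurable_latitudePt_right (θ : ℝ) : Measurable (latitudePt n θ) :=
  (continuous_latitudePt_right n θ).measurable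

/-- `⟪e₀, latitudePt θ w⟫ = cos θ`. -/
theorem inner_polarAxis_latitudePt (θ : ℝ) (w : sphere (0 : EuclideanSpace ℝ (Fin (n + 1))) 1) :
    ⟪polarAxis n, (latitudePt n θ w : EuclideanSpace ℝ (Fin (n + 2)))⟫_ℝ = cos θ := by
  rw [coe_latitudePt, inner_add_right, real_inner_smul_right, real_inner_smul_right,
    real_inner_self_eq_norm_sq, norm_polarAxis, inner_polarAxis_equatorEmbed]
  ring

/-- **The polar angle of a latitude point is its latitude parameter**: for `θ ∈ [0, π]`,
`angle e₀ (latitudePt θ w) = θ`. -/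
theorem angle_polarAxis_latitudePt {θ : ℝ} (hθ : θ ∈ Icc 0 π)
    (w : sphere (0 : EuclideanSpace ℝ (Fin (n + 1))) 1) :
    angle (polarAxis n) (latitudePt n θ w : EuclideanSpace ℝ (Fin (n + 2))) = θ := by
  rw [angle, inner_polarAxis_latitudePt, norm_polarAxis, norm_eq_of_mem_sphere, mul_one, div_one,
    arccos_cos hθ.1 hθ.2]

/-- **Polar coordinates in the axis plane land on rays through latitude points**:
`(r cos θ) • e₀ + (0, (r sin θ) • w) = r • latitudePt θ w`. -/
theorem axisCoords_symm_polar (r θ : ℝ) (w : sphere (0 : EuclideanSpace ℝ (Fin (n + 1))) 1) :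
    (axisCoords n).symm (r * cos θ, (r * sin θ) • (w : EuclideanSpace ℝ (Fin (n + 1)))) =
      r • (latitudePt n θ w : EuclideanSpace ℝ (Fin (n + 2))) := by
  rw [axisCoords_symm_apply_eq, map_smul, coe_latitudePt, smul_add, smul_smul, smul_smul, mul_smul,
    mul_smul, smul_smul, smul_smul]

/-- `‖(t, s • w)‖² = t² + s²` for `w` on the equatorial sphere. -/
theorem norm_sq_axisCoords_symm_smul (t s : ℝ) (w : sphere (0 : EuclideanSpace ℝ (Fin (n + 1))) 1) :
    ‖(axisCoords n).symm (t, s • (w : EuclideanSpace ℝ (Fin (n + 1))))‖ ^ 2 = t ^ 2 + s ^ 2 := by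
  rw [norm_sq_axisCoords_symm, norm_smul, norm_eq_of_mem_sphere, mul_one, Real.norm_eq_abs, sq_abs]

/-! ## Directions of rays -/

section Direction

variable {E : Type*} [NormedAddCommGroup E] [NormedSpace ℝ E] [Nontrivial E]

/-- The direction of a point of the unit sphere is itself. -/
theorem dirSphere_coe_sphere (u : sphere (0 : E) 1) : dirSphere (u : E) = u := by
  apply Subtype.ext
  rw [dirSphere_coe (ne_zero_of_mem_unit_sphere u), norm_eq_of_mem_sphere, inv_one, one_smul]

/-- The direction of a positive multiple of a unit vector `u` is `u`. -/
theorem dirSphere_smul_coe {r : ℝ} (hr : 0 < r) (u : sphere (0 : E) 1) :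
    dirSphere (r • (u : E)) = u := by
  rw [dirSphere_smul hr, dirSphere_coe_sphere]

end Direction

/-! ## The leading-order kick in latitude coordinates -/

/-- **The LO site update in latitude coordinates is `kickAngle × id`.**  With the local field
along the axis, `J = r • e₀` (`r > 0`), and step constant `c`, the Engel–Schaefer single-site map
sends `latitudePt θ w ↦ latitudePt (kickAngle (c r) θ) w` for every `θ ∈ (0, π)` and every
equatorial point `w`: the polar angle is moved by the one-dimensional map `kickAngle (c r)` of
`KickAngleMap.lean`, the equatorial point is untouched (`SphereGeodesicKick.geodesicKick_meridian`). -/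
theorem geodesicKick_latitudePt (c : ℝ) {r : ℝ} (hr : 0 < r) {θ : ℝ} (hθ : θ ∈ Ioo 0 π)
    (w : sphere (0 : EuclideanSpace ℝ (Fin (n + 1))) 1) :
    geodesicKick c (r • polarAxis n) (latitudePt n θ w : EuclideanSpace ℝ (Fin (n + 2))) =
      (latitudePt n (kickAngle (c * r) θ) w : EuclideanSpace ℝ (Fin (n + 2))) := by
  rw [coe_latitudePt, coe_latitudePt]
  exact geodesicKick_meridian c (norm_polarAxis n)
    (by rw [norm_equatorEmbed]; exact norm_eq_of_mem_sphere w) (inner_polarAxis_equatorEmbed n w) hr hθ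

/-- The polar angle from a field along the axis is the polar angle from the axis:
`angle (r • e₀) x = angle e₀ x` for `r > 0`. -/
theorem angle_smul_polarAxis {r : ℝ} (hr : 0 < r) (x : EuclideanSpace ℝ (Fin (n + 2))) :
    angle (r • polarAxis n) x = angle (polarAxis n) x :=
  angle_smul_left_of_pos _ _ hr

end Summit.Ventures.LatticeQCDFlow.Exactness

end
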